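import Summits.ResolutionOfSingularities.ResolutionOfSingularities.Theorems.EquisingularLiftEquisingularLiftNatFibreIntegralLocal
import Summits.ResolutionOfSingularities.ResolutionOfSingularities.Theorems.EquisingularLiftEquisingularLiftNatCarrierDeltaComapFrame
import Literature.AlgebraicGeometry.Resolution.BlowupsFlatBaseChange
import Literature.AlgebraicGeometry.Resolution.ComponentGluing
import HarnessLib

/-!
# [OURS · L1 W4.5(b) · EL♮(3) · D6 HSUBᵉ, brick (FI) «fibre-integral transport», GLOBAL STEP] A LOCALLY NOETHERIAN SCHEME, FLAT AND
# UNIVERSALLY CLOSED OVER A DVR, WHOSE SPECIAL FIBRE IS INTEGRAL, IS INTEGRAL — and the closed-subscheme form JINIT consumes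

res-L1-w45b-stub-4 g12 (free pen after ✓ p677149; res-L1-w45b-idea-3's (FI) l.84158, whose local kernel is ✓ p678468
`…NatFibreIntegralLocal`; consumer: res-L1-w45b-nose-w1's JINIT brick `jinit_rPlus₀`, clause `IsIntegral 𝓦₀.subscheme` of `NoseDatum`
(res-type-027 (R1))). Crux `EquisingularLiftNatThree` = stmt-ResolutionOfSingularities-20148 (parent stmt-…-20038), route `EquisingularLift`,
line `sections`. OURS — folklore algebraic geometry, NOT a statement of any manuscript ([Hironaka2017] is a candidate under adjudication;
nothing of it is asserted); AI-written, weaker than expert review. No `sorry`, no definition, no instance; standard axioms.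
`--supports stmt-ResolutionOfSingularities-20148 --as helper`.

WHAT. `O` a DVR with residue map `θ : O ↠ k`, `f : X → Spec O` with `X` locally noetherian, and the special fibre `j : G → X` given by a
cartesian square `j ≫ f = t ≫ Spec θ`.
* `isDomain_stalk_fibre` — if `f` is FLAT and `G` is INTEGRAL, every local ring `𝒪_{X, j y}` is a domain: `ker (j^♯_y) = (ϖ̃)`
  (✓ `ker_stalkMap_model_le` + ✓ `stalkMap_model_varpi`), `ϖ̃` is a non-zero-divisor (flat stalk map, Literature ✓
  `map_mem_nonZeroDivisors_of_flat`), `𝒪_{G,y}` is a domain, and ✓ `FibreIntegral.isDomain_of_ker_eq_span_singleton` (p678468).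
* `exists_specializes_fibre` — if `f` is UNIVERSALLY CLOSED, every point of `X` specialises to a point of the special fibre.
* `isDomain_of_isLocalization_atPrime_of_le` — pure algebra: `R_𝔭` is a domain when `R_𝔮` is, for primes `𝔭 ≤ 𝔮`; hence
  `isDomain_stalk_of_specializes`: a domain stalk passes to every generisation.
* ★ `isIntegral_of_flat_of_isIntegral_fibre` — `X` locally noetherian, `f` flat and universally closed, `G` integral ⇒ `X` integral
  (reduced: all stalks are domains; irreducible: the generic point `ξ` of `Spec 𝒪_{X, j γ}` (`γ` the generic point of `G`) specialises to
  every point, by maximality of generic points of irreducible components and ✓ `Scheme.range_fromSpecStalk`).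
* ★ `isIntegral_subscheme_of_flat_of_comap_eq_vanishingIdeal` — the form JINIT consumes: for an ideal sheaf `𝓦` on `X` with
  `V(𝓦) → Spec O` flat, `f` universally closed and REDUCED IRREDUCIBLE TRACE `𝓦·𝒪_G = 𝓘⟨W⟩` (`W` closed irreducible), `V(𝓦)` is integral
  (the trace square `V(𝓦·𝒪_G) → V(𝓦)` is cartesian, Mathlib `IdealSheafData.comapIso`; `V(𝓘⟨W⟩)` is integral, Literature ✓
  `ComponentGluing.isIntegral_subscheme_vanishingIdeal`).
The hypothesis «universally closed» cannot be weakened to «every irreducible component meets the special fibre»: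
`X = Spec O[t,u]/(u², u(ϖt − 1))` is `O`-flat with integral special fibre `𝔸¹_k` and one component, but is not reduced.

References: H. Matsumura, *Commutative Ring Theory* (1986), Thm. 8.10 [Matsumura1987]; The Stacks Project, Tags 00E0, 01J7 [StacksProject];
R. Hartshorne, *Algebraic Geometry* (1977), III Prop. 9.7 [Hartshorne1977] — folklore; through the cited tree files (all OURS, imported).
-/

set_option linter.dupNamespace false -- mandated namespace `Summit.<Summit>.<Problem>` of this single-conjunct summit
set_option linter.overlappingInstances false -- the binders carry `[IsDomain O] [IsDiscreteValuationRing O]`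

noncomputable section

open CategoryTheory CategoryTheory.Limits AlgebraicGeometry TopologicalSpace Topology IsLocalRing
open Literature.AlgebraicGeometry.Resolution
open AlgebraicGeometry.Scheme.IdealSheafData
open Summit.ResolutionOfSingularities.ResolutionOfSingularities.Cruxes.EquisingularLift.StrataSplit

namespace Summit.ResolutionOfSingularities.ResolutionOfSingularities.Cruxes.EquisingularLiftNat.Sections

namespace FibreIntegral

/-! ## §0 Algebra: a domain local ring passes to localisations at smaller primes -/

/-- **`R_𝔭` is a domain when `R_𝔮` is, for `𝔭 ≤ 𝔮`** (`R_𝔭` is a localisation of `R_𝔮`; written out with `IsLocalization.mk'`).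
[folklore] -/
theorem isDomain_of_isLocalization_atPrime_of_le {R : Type*} [CommRing R] (P Q : Ideal R) [P.IsPrime] [Q.IsPrime] (hPQ : P ≤ Q)
    (S T : Type*) [CommRing S] [CommRing T] [Algebra R S] [Algebra R T] [IsLocalization.AtPrime S Q] [IsLocalization.AtPrime T P]
    [IsDomain S] : IsDomain T := by
  haveI : Nontrivial T := IsLocalization.AtPrime.nontrivial T P
  -- `algebraMap R S r = 0` forces `mk' r s = 0` in `T`
  have hzero : ∀ (r : R) (s : P.primeCompl), algebraMap R S r = 0 → IsLocalization.mk' T r s = 0 := by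
    intro r s hr
    obtain ⟨v, hvr⟩ := (IsLocalization.map_eq_zero_iff Q.primeCompl S r).mp hr
    exact (IsLocalization.mk'_eq_zero_iff r s).mpr ⟨⟨(v : R), fun hvP => v.2 (hPQ hvP)⟩, hvr⟩
  haveI : NoZeroDivisors T := ⟨fun {a b} hab => by
    obtain ⟨⟨r₁, s₁⟩, rfl⟩ := IsLocalization.mk'_surjective P.primeCompl a
    obtain ⟨⟨r₂, s₂⟩, rfl⟩ := IsLocalization.mk'_surjective P.primeCompl b
    rw [← IsLocalization.mk'_mul, IsLocalization.mk'_eq_zero_iff] at hab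
    obtain ⟨m, hur⟩ := hab
    -- in the domain `S`: `m · r₁ · r₂ ↦ 0`, and `m ↦` a non-zero element
    have hS : algebraMap R S (m : R) * (algebraMap R S r₁ * algebraMap R S r₂) = 0 := by
      rw [← map_mul, ← map_mul, hur, map_zero]
    have hu0 : algebraMap R S (m : R) ≠ 0 := by
      intro h0
      obtain ⟨v, hvu⟩ := (IsLocalization.map_eq_zero_iff Q.primeCompl S (m : R)).mp h0
      have hvuP : (v : R) * (m : R) ∈ P := by rw [hvu]; exact P.zero_mem
      rcases (‹P.IsPrime›.mem_or_mem hvuP) with hvP | huP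
      · exact v.2 (hPQ hvP)
      · exact m.2 huP
    rcases mul_eq_zero.mp ((mul_eq_zero.mp hS).resolve_left hu0) with h1 | h2
    · exact Or.inl (hzero r₁ s₁ h1)
    · exact Or.inr (hzero r₂ s₂ h2)⟩
  exact NoZeroDivisors.to_isDomain T

/-- **A domain stalk passes to every generisation**: if `x ⤳ x₀` and `𝒪_{X,x₀}` is a domain then so is `𝒪_{X,x}` (both are
localisations of the coordinate ring of an affine neighbourhood of `x₀`, at nested primes). [folklore] -/
theorem isDomain_stalk_of_specializes {X : Scheme.{0}} {x x₀ : X} (h : x ⤳ x₀) [IsDomain (X.presheaf.stalk x₀)] :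
    IsDomain (X.presheaf.stalk x) := by
  obtain ⟨U, hU, hx₀U, -⟩ := exists_isAffineOpen_mem_and_subset (X := X) (x := x₀) (U := ⊤) trivial
  have hxU : x ∈ U := h.mem_open U.2 hx₀U
  letI := TopCat.Presheaf.algebra_section_stalk X.presheaf (⟨x₀, hx₀U⟩ : U)
  letI := TopCat.Presheaf.algebra_section_stalk X.presheaf (⟨x, hxU⟩ : U)
  haveI := hU.isLocalization_stalk ⟨x₀, hx₀U⟩
  haveI := hU.isLocalization_stalk ⟨x, hxU⟩
  have hspec : (⟨x, hxU⟩ : U) ⤳ (⟨x₀, hx₀U⟩ : U) := Topology.IsInducing.subtypeVal.specializes_iff.mp h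
  have hle : hU.primeIdealOf ⟨x, hxU⟩ ≤ hU.primeIdealOf ⟨x₀, hx₀U⟩ :=
    (PrimeSpectrum.le_iff_specializes _ _).mpr (hspec.map hU.isoSpec.hom.continuous)
  haveI : IsDomain (X.presheaf.stalk ((⟨x₀, hx₀U⟩ : U) : X)) := ‹IsDomain (X.presheaf.stalk x₀)›
  exact isDomain_of_isLocalization_atPrime_of_le (hU.primeIdealOf ⟨x, hxU⟩).asIdeal (hU.primeIdealOf ⟨x₀, hx₀U⟩).asIdeal hle
    (X.presheaf.stalk ((⟨x₀, hx₀U⟩ : U) : X)) (X.presheaf.stalk ((⟨x, hxU⟩ : U) : X))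

/-! ## §1 The model square over a DVR: fibre stalks are domains, every point specialises into the fibre -/

section Fibre

variable (O : Type) [CommRing O] [IsDomain O] [IsDiscreteValuationRing O] {k : Type} [Field k] (θ : O →+* k)
  (hθ : Function.Surjective θ) {X G : Scheme.{0}} (f : X ⟶ Spec (.of O)) (j : G ⟶ X) (t : G ⟶ Spec (.of k))
  (hsq : IsPullback j t f (Spec.map (CommRingCat.ofHom θ)))

include hθ hsq in
/-- **Fibre stalks are domains.** `f : X → Spec O` FLAT, `X` locally noetherian, special fibre `G` INTEGRAL ⇒ `𝒪_{X, j y}` is a domain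
for every `y ∈ G`: `ker j^♯_y = (ϖ̃)` with `ϖ̃ ∈ 𝔪` a non-zero-divisor and `𝒪_{G,y}` a domain (✓ p678468). [cite: Matsumura1987, Thm. 8.10] -/
theorem isDomain_stalk_fibre [IsLocallyNoetherian X] [Flat f] [IsIntegral G] (y : G) : IsDomain (X.presheaf.stalk (j y)) := by
  obtain ⟨ϖ, hϖ⟩ := IsDiscreteValuationRing.exists_irreducible O
  have hϖm : ϖ ∈ maximalIdeal O := hϖ.maximalIdeal_eq ▸ Ideal.mem_span_singleton_self ϖ
  -- `ker j^♯_y = (ϖ̃)`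
  have hkill : (j.stalkMap y).hom ((X.presheaf.Γgerm (j y)).hom (f.appTop.hom ((Scheme.ΓSpecIso (.of O)).inv.hom ϖ))) = 0 :=
    stalkMap_model_varpi θ hθ f j t hsq y ϖ hϖm
  have hker : RingHom.ker (j.stalkMap y).hom =
      Ideal.span {(X.presheaf.Γgerm (j y)).hom (f.appTop.hom ((Scheme.ΓSpecIso (.of O)).inv.hom ϖ))} :=
    le_antisymm (ker_stalkMap_model_le O k θ hθ f j t hsq y ϖ hϖ)
      ((Ideal.span_singleton_le_iff_mem _).mpr ((RingHom.mem_ker).mpr hkill))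
  -- `ϖ̃ ∈ 𝔪`
  have hmax : (X.presheaf.Γgerm (j y)).hom (f.appTop.hom ((Scheme.ΓSpecIso (.of O)).inv.hom ϖ)) ∈
      maximalIdeal (X.presheaf.stalk (j y)) := by
    rw [IsLocalRing.mem_maximalIdeal, mem_nonunits_iff]
    intro hu
    have h := hu.map (j.stalkMap y).hom
    rw [hkill] at h
    exact not_isUnit_zero h
  -- `ϖ̃` is a non-zero-divisor: the flat stalk map `f^♯` applied to the non-zero germ of `ϖ` on the integral `Spec O`
  have hreg : (X.presheaf.Γgerm (j y)).hom (f.appTop.hom ((Scheme.ΓSpecIso (.of O)).inv.hom ϖ)) ∈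
      nonZeroDivisors (X.presheaf.stalk (j y)) := by
    have hgerm : ((Spec (.of O)).presheaf.Γgerm (f (j y))).hom ((Scheme.ΓSpecIso (.of O)).inv.hom ϖ) ∈
        nonZeroDivisors ((Spec (.of O)).presheaf.stalk (f (j y))) := by
      apply mem_nonZeroDivisors_of_ne_zero
      intro h0
      have hinj := germ_injective_of_isIntegral (Spec (.of O)) (U := ⊤) (f (j y)) trivial
      have h1 : (Spec (.of O)).presheaf.germ ⊤ (f (j y)) trivial ((Scheme.ΓSpecIso (.of O)).inv.hom ϖ) =
          (Spec (.of O)).presheaf.germ ⊤ (f (j y)) trivial 0 := by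
        rw [map_zero]; exact h0
      have h2 : (Scheme.ΓSpecIso (.of O)).inv.hom ϖ = 0 := hinj h1
      have h3 : ϖ = 0 := by simpa using congrArg (fun z => (Scheme.ΓSpecIso (.of O)).hom.hom z) h2
      exact hϖ.ne_zero h3
    have h := map_mem_nonZeroDivisors_of_flat (f.stalkMap (j y)).hom (Flat.stalkMap f (j y)) hgerm
    rwa [stalkMap_Γgerm_apply'] at h
  exact isDomain_of_ker_eq_span_singleton (j.stalkMap y).hom hker hmax hreg

include hθ hsq in
/-- **Every point specialises into the special fibre** when `f` is universally closed: the image of `closure {x}` is closed in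
`Spec O`, contains `f x`, hence the closed point. [cite: StacksProject, Tag 00E0] -/
theorem exists_specializes_fibre [UniversallyClosed f] (x : X) : ∃ y : G, x ⤳ j y := by
  have hcl : IsClosed (f '' closure {x}) := f.isClosedMap _ isClosed_closure
  have hmem : closedPoint O ∈ f '' closure {x} :=
    (IsLocalRing.specializes_closedPoint (f x)).mem_closed hcl ⟨x, subset_closure rfl, rfl⟩
  obtain ⟨x', hx', hfx'⟩ := hmem
  have hx'r : x' ∈ Set.range j := by
    rw [range_eq_preimage_of_isPullback hsq, range_specMap_of_surjective_of_field θ hθ]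
    exact hfx'
  obtain ⟨y, rfl⟩ := hx'r
  exact ⟨y, specializes_iff_mem_closure.mpr hx'⟩

end Fibre

/-! ## §2 The main theorem and its closed-subscheme form -/

/-- **For a DOMAIN stalk `𝒪_{X,x₀}`, the image `ξ₀` of the generic point of `Spec 𝒪_{X,x₀}` specialises to every generisation of `x₀`**
(Mathlib `Scheme.range_fromSpecStalk`). [cite: StacksProject, Tag 01J7] -/
theorem fromSpecStalk_bot_specializes {X : Scheme.{0}} (x₀ : X) [IsDomain (X.presheaf.stalk x₀)] {z : X} (hz : z ⤳ x₀) :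
    X.fromSpecStalk x₀ (⟨⊥, Ideal.isPrime_bot⟩ : PrimeSpectrum (X.presheaf.stalk x₀)) ⤳ z := by
  have hzr : z ∈ Set.range (X.fromSpecStalk x₀) := by rw [Scheme.range_fromSpecStalk]; exact hz
  obtain ⟨p, rfl⟩ := hzr
  exact ((PrimeSpectrum.le_iff_specializes _ p).mp bot_le).map (X.fromSpecStalk x₀).continuous

section Main

variable (O : Type) [CommRing O] [IsDomain O] [IsDiscreteValuationRing O] {k : Type} [Field k] (θ : O →+* k)
  (hθ : Function.Surjective θ) {X G : Scheme.{0}} (f : X ⟶ Spec (.of O)) (j : G ⟶ X) (t : G ⟶ Spec (.of k))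
  (hsq : IsPullback j t f (Spec.map (CommRingCat.ofHom θ)))

include hθ hsq in
/-- ★ **(FI) A locally noetherian scheme, FLAT and UNIVERSALLY CLOSED over a DVR, whose special fibre is INTEGRAL, is integral.**
Reduced: every stalk is a domain (fibre stalks by `isDomain_stalk_fibre`, the others by generisation). Irreducible: with `γ` the generic
point of `G` and `ξ` the image of the generic point of `Spec 𝒪_{X, j γ}`, every generic point `m` of an irreducible component specialises
to some `j y`, so `ξ_y = m` (maximality of `m`), while `ξ ⤳ j γ ⤳ j y` gives `ξ_y ⤳ ξ`, so `ξ_y = ξ` (maximality of `ξ`): `ξ ⤳ m ⤳ x` for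
every `x`. [cite: StacksProject, Tag 01J7; Matsumura1987, Thm. 8.10] -/
theorem isIntegral_of_flat_of_isIntegral_fibre [IsLocallyNoetherian X] [UniversallyClosed f] [Flat f] [IsIntegral G] :
    IsIntegral X := by
  -- every stalk is a domain
  have hdom : ∀ x : X, IsDomain (X.presheaf.stalk x) := fun x => by
    obtain ⟨y, hy⟩ := exists_specializes_fibre O θ hθ f j t hsq x
    haveI := isDomain_stalk_fibre O θ hθ f j t hsq y
    exact isDomain_stalk_of_specializes hy
  haveI : ∀ x : X, _root_.IsReduced (X.presheaf.stalk x) := fun x => by haveI := hdom x; infer_instance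
  haveI : IsReduced X := isReduced_of_isReduced_stalk X
  -- the candidate generic point `ξ`
  haveI := hdom (j (genericPoint G))
  set ξ : X := X.fromSpecStalk (j (genericPoint G)) (⟨⊥, Ideal.isPrime_bot⟩ : PrimeSpectrum (X.presheaf.stalk (j (genericPoint G))))
    with hξ
  have hξγ : ξ ⤳ j (genericPoint G) := fromSpecStalk_bot_specializes (j (genericPoint G)) le_rfl
  -- `ξ` is maximal for specialisation
  have hξmax : ∀ z : X, z ⤳ ξ → z = ξ := fun z hz =>
    ((fromSpecStalk_bot_specializes (j (genericPoint G)) (hz.trans hξγ)).antisymm hz).eq.symm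
  -- every point is a specialisation of `ξ`
  have hall : ∀ x : X, ξ ⤳ x := by
    intro x
    obtain ⟨m, hmgen⟩ : ∃ m : X, IsGenericPoint m (irreducibleComponent x) :=
      QuasiSober.sober isIrreducible_irreducibleComponent isClosed_irreducibleComponent
    have hmx : m ⤳ x := hmgen.specializes mem_irreducibleComponent
    obtain ⟨y, hmy⟩ := exists_specializes_fibre O θ hθ f j t hsq m
    haveI := isDomain_stalk_fibre O θ hθ f j t hsq y
    -- `ξ_y ⤳ m`, hence `ξ_y = m` (generic points of irreducible components are maximal)
    have h1 := fromSpecStalk_bot_specializes (j y) hmy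
    have hC : IsGenericPoint (X.fromSpecStalk (j y) (⟨⊥, Ideal.isPrime_bot⟩ : PrimeSpectrum (X.presheaf.stalk (j y))))
        (irreducibleComponent x) := by
      have hsub : irreducibleComponent x ⊆ closure {X.fromSpecStalk (j y) (⟨⊥, Ideal.isPrime_bot⟩ : PrimeSpectrum _)} := by
        have e : closure {m} = irreducibleComponent x := hmgen
        rw [← e]
        exact closure_minimal (Set.singleton_subset_iff.mpr (specializes_iff_mem_closure.mp h1)) isClosed_closure
      exact isGenericPoint_def.mpr (eq_irreducibleComponent isIrreducible_singleton.closure.isPreirreducible hsub)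
    have hm : X.fromSpecStalk (j y) (⟨⊥, Ideal.isPrime_bot⟩ : PrimeSpectrum (X.presheaf.stalk (j y))) = m := hC.eq hmgen
    -- `ξ ⤳ j y`, hence `ξ_y ⤳ ξ`, hence `ξ_y = ξ`
    have h2 : ξ ⤳ j y := hξγ.trans ((genericPoint_specializes y).map j.continuous)
    have h3 := hξmax _ (fromSpecStalk_bot_specializes (j y) h2)
    rw [← h3, hm]
    exact hmx
  haveI : PreirreducibleSpace X := ⟨by
    rw [← (Set.eq_univ_iff_forall.mpr fun x => specializes_iff_mem_closure.mp (hall x) : closure ({ξ} : Set X) = Set.univ)]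
    exact isIrreducible_singleton.closure.isPreirreducible⟩
  haveI : IrreducibleSpace X := ⟨⟨ξ⟩⟩
  exact isIntegral_of_irreducibleSpace_of_isReduced X

end Main

section Subscheme

variable (O : Type) [CommRing O] [IsDomain O] [IsDiscreteValuationRing O] {k : Type} [Field k] (θ : O →+* k)
  (hθ : Function.Surjective θ) {X G : Scheme.{0}} (f : X ⟶ Spec (.of O)) (j : G ⟶ X) (t : G ⟶ Spec (.of k))
  (hsq : IsPullback j t f (Spec.map (CommRingCat.ofHom θ)))

omit [IsDomain O] [IsDiscreteValuationRing O] in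
include hsq in
/-- **The trace square of a closed subscheme is cartesian**: `V(𝓦·𝒪_G) → V(𝓦)` is the base change of the special-fibre inclusion `j`
(Mathlib `IdealSheafData.comapIso` pasted with the model square; cf. Literature ✓ `isPullback_subschemeι_comap`). [folklore] -/
theorem isPullback_subschemeι_comap_model (𝓦 : X.IdealSheafData) :
    IsPullback ((𝓦.comapIso j).hom ≫ pullback.snd j 𝓦.subschemeι) ((𝓦.comap j).subschemeι ≫ t) (𝓦.subschemeι ≫ f)
      (Spec.map (CommRingCat.ofHom θ)) := by
  -- adapted from Literature/AlgebraicGeometry/Resolution/BlowupSequencesBaseChange.lean (`isPullback_subschemeι_comap`)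
  have H2 : IsPullback (pullback.snd j 𝓦.subschemeι) (pullback.fst j 𝓦.subschemeι ≫ t) (𝓦.subschemeι ≫ f)
      (Spec.map (CommRingCat.ofHom θ)) :=
    (IsPullback.of_hasPullback j 𝓦.subschemeι).flip.paste_vert hsq
  have H3 : IsPullback (𝓦.comapIso j).hom ((𝓦.comapIso j).hom ≫ (pullback.fst j 𝓦.subschemeι ≫ t))
      (pullback.fst j 𝓦.subschemeι ≫ t) (𝟙 _) :=
    IsPullback.of_horiz_isIso ⟨by rw [Category.comp_id]⟩
  have H4 : IsPullback ((𝓦.comapIso j).hom ≫ pullback.snd j 𝓦.subschemeι)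
      ((𝓦.comapIso j).hom ≫ (pullback.fst j 𝓦.subschemeι ≫ t)) (𝓦.subschemeι ≫ f) (𝟙 _ ≫ Spec.map (CommRingCat.ofHom θ)) :=
    H3.paste_horiz H2
  simpa using H4

include hθ hsq in
/-- ★ **(FI), CLOSED-SUBSCHEME FORM — what JINIT consumes.** `X` locally noetherian, `f : X → Spec O` universally closed, `𝓦` an ideal
sheaf with `V(𝓦) → Spec O` FLAT and REDUCED IRREDUCIBLE TRACE on the special fibre, `𝓦·𝒪_G = 𝓘⟨W⟩` with `W` closed irreducible ⇒
`V(𝓦)` is an integral scheme. (At the initial stage of the EL♮(3) chain: `X = ℙ³_O`, `f = q` proper, `j = Proj φ`, `𝓦 = 𝓦₀` the nose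
model.) [cite: StacksProject, Tag 01J7; Matsumura1987, Thm. 8.10] -/
theorem isIntegral_subscheme_of_flat_of_comap_eq_vanishingIdeal [IsLocallyNoetherian X] [UniversallyClosed f]
    (𝓦 : X.IdealSheafData) (W : Set G) (hW : IsClosed W) (hWirr : IsIrreducible W)
    (hcomap : 𝓦.comap j = vanishingIdeal (⟨W, hW⟩ : Closeds G)) (hflat : Flat (𝓦.subschemeι ≫ f)) :
    IsIntegral 𝓦.subscheme := by
  have hsqW := isPullback_subschemeι_comap_model O θ f j t hsq 𝓦
  haveI : IsIntegral (𝓦.comap j).subscheme := by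
    rw [hcomap]
    exact ComponentGluing.isIntegral_subscheme_vanishingIdeal ⟨W, hW⟩ hWirr
  haveI : IsLocallyNoetherian 𝓦.subscheme := LocallyOfFiniteType.isLocallyNoetherian 𝓦.subschemeι
  haveI : UniversallyClosed (𝓦.subschemeι ≫ f) := inferInstance
  haveI := hflat
  exact isIntegral_of_flat_of_isIntegral_fibre O θ hθ (𝓦.subschemeι ≫ f) _ _ hsqW

end Subscheme

end FibreIntegral

end Summit.ResolutionOfSingularities.ResolutionOfSingularities.Cruxes.EquisingularLiftNat.Sections

end
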